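import Literature.Algebra.Homology.OrderedCechDeletion
import Literature.AlgebraicGeometry.Motives.AffineCechAcyclic
import HarnessLib

/-!
# Čech complexes of pointwise families and the comparison of a covering with a sub-covering
# (Görtz–Wedhorn II, Thm. 22.9 / Cor. 21.82, for subsheaves of a constant sheaf)

A subsheaf `𝓕` of a constant sheaf `𝕂` on a space `X` (e.g. `𝒪_Y(D) ⊆ 𝒦_Y`, `𝒪_Z(n) ⊆ 𝒦_Z`,
`π_*𝒪_{V'}(n) ⊆ 𝒦_V` on integral schemes) is determined by its stalks `P x ⊆ 𝕂`, and its sections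
are intersections of stalks: `Γ(W, 𝓕) = ⋂_{x ∈ W} P x` (`PtFamily.secs`). For such POINTWISE families
the sheaf axiom is automatic, and the ordered Čech complex (`Literature/Algebra/Homology/OrderedCech`)
of a finite family of opens `(W_j)_{j ∈ S}` inside an ambient open `Ω` is that of the monotone family
`t ↦ Γ(Ω ∩ W_t, 𝓕)`, `W_t = ⋂_{j ∈ t} W_j` (`PtFamily.cechFam`, `PtFamily.cplx P Ω W S`).

This file turns the deletion theorem `OrderedCech.quasiIso_restrictMapLE_of_forall`
(`Literature/Algebra/Homology/OrderedCechDeletion`) into ready-to-use comparison theorems for such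
complexes, with all index bookkeeping (sub-types of finite sets of indices) done once here:

* `PtFamily.quasiIso_restrictJ` — **restriction to a sub-covering `J ⊆ T` covering `Ω` is a
  quasi-isomorphism as soon as every deleted member `W_v` is Čech-acyclic** for the coverings
  `(W_v ∩ W_j)_{j ∈ S}`, `J ⊆ S ⊆ T` (Görtz–Wedhorn II, Thm. 22.9 with Cor. 21.82; the degree-`0`
  hypothesis of the deletion theorem holds automatically for pointwise families);
* `PtFamily.exactAt_cplx_of_base`, `PtFamily.quasiIso_restrictJ_of_base` — **the recursive form**:
  it suffices that `𝓕` be Čech-acyclic on the intersections `W_s = ⋂_{a ∈ s} W_a` of the DELETED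
  members for the sub-covering `J` alone (induction on the number of extra members; this is the
  shape in which Serre's vanishing theorem enters for the non-affine members `π⁻¹(U_a)` of a Chow
  cover, Görtz–Wedhorn II, proof of Thm. 23.17 via Lemma 23.19 / Leray);
* `PtFamily.exactAt_cplx_of_affine`, `PtFamily.quasiIso_restrictJ_of_affine` — **deleting affine
  members**: on an affine `W_v` on which `𝓕 = φ⁻¹𝒪` is principal, with all `W_v ∩ W_t` affine, the
  links are exact by `AffineCech.exactAt_complex_of_affine` (`Motives/AffineCechAcyclic`;
  Görtz–Wedhorn II, Lemma 22.1).

Everything is proved; no named facts. Mathlib searched (pin): no Čech cohomology of (pre)sheaves on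
schemes; `HomologicalComplex.exactAt_iff_of_quasiIsoAt`, `HomologicalComplex.ExactAt.of_iso` (used).

## References

* U. Görtz, T. Wedhorn, *Algebraic Geometry II: Cohomology of Schemes*, Springer Spektrum (2023),
  doi:10.1007/978-3-658-43031-3: Cor. 21.82 (p. 266), Lemma 22.1 and Thm. 22.2 (pp. 327–328),
  Thm. 22.9 (p. 332), Thm. 23.17 with Lemma 23.19 (pp. 424–426). [GortzWedhorn2023]
* The Stacks Project, Tags 01X9, 01XD (Čech cohomology and affine coverings). [StacksProject]
-/

noncomputable section

universe u

open CategoryTheory TopologicalSpace AlgebraicGeometry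
open Literature.Algebra.Homology Literature.Algebra.Homology.OrderedCech

namespace Literature.AlgebraicGeometry.Motives

namespace PtFamily

section General

variable {X : Type u} [TopologicalSpace X] {A : Type u} [CommRing A] {𝕂 : Type u} [AddCommGroup 𝕂]
  [Module A 𝕂]

/-! ### Sections of a pointwise family -/

/-- **`Γ(W, P) = ⋂_{x ∈ W} P x`**: the sections over `W` of the pointwise family (`= subsheaf of the
constant sheaf `𝕂`) with stalks `P x`. [folklore] -/
def secs (P : X → Submodule A 𝕂) (W : Opens X) : Submodule A 𝕂 := ⨅ x : W, P x

/-- Membership in `Γ(W, P)`. [folklore] -/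
theorem mem_secs {P : X → Submodule A 𝕂} {W : Opens X} {v : 𝕂} :
    v ∈ secs P W ↔ ∀ x ∈ W, v ∈ P x := by
  rw [secs, Submodule.mem_iInf]
  exact ⟨fun h x hx => h ⟨x, hx⟩, fun h x => h x x.2⟩

/-- Restriction is inclusion: `Γ(W, P) ⊆ Γ(W', P)` for `W' ⊆ W`. [folklore] -/
theorem secs_anti (P : X → Submodule A 𝕂) {W W' : Opens X} (h : W' ≤ W) : secs P W ≤ secs P W' :=
  fun _ hv => mem_secs.2 fun x hx => mem_secs.1 hv x (h hx)

variable {κ : Type} [LinearOrder κ]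

/-- Membership in a finite intersection of opens. [folklore] -/
theorem mem_finset_inf {W : κ → Opens X} {t : Finset κ} {x : X} :
    x ∈ t.inf W ↔ ∀ a ∈ t, x ∈ W a := by
  classical
  induction t using Finset.induction_on with
  | empty => simp
  | insert a t _ ih => rw [Finset.inf_insert, Opens.mem_inf, ih, Finset.forall_mem_insert]

/-! ### The Čech family of a finite family of opens -/

/-- **The Čech family `t ↦ Γ(Ω ∩ W_t, P)`**, `W_t = ⋂_{a ∈ t} W_a` (`W_∅ = X`), of the pointwise
family `P` for the opens `W` inside the ambient open `Ω`. [folklore] -/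
def cechFam (P : X → Submodule A 𝕂) (Ω : Opens X) (W : κ → Opens X) (t : Finset κ) : Submodule A 𝕂 :=
  secs P (Ω ⊓ t.inf W)

omit [LinearOrder κ] in
/-- The Čech family is monotone (restriction is inclusion). [folklore] -/
theorem cechFam_mono (P : X → Submodule A 𝕂) (Ω : Opens X) (W : κ → Opens X) :
    Monotone (cechFam P Ω W) := fun _ _ hst =>
  secs_anti P (inf_le_inf_left Ω (Finset.inf_mono hst))

/-- Membership in the Čech family. [folklore] -/
theorem mem_cechFam {P : X → Submodule A 𝕂} {Ω : Opens X} {W : κ → Opens X} {t : Finset κ} {v : 𝕂} :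
    v ∈ cechFam P Ω W t ↔ ∀ x ∈ Ω, (∀ a ∈ t, x ∈ W a) → v ∈ P x := by
  rw [cechFam, mem_secs]
  exact ⟨fun h x hx hx' => h x ⟨hx, mem_finset_inf.2 hx'⟩,
    fun h x hx => h x hx.1 (mem_finset_inf.1 hx.2)⟩

/-- Two Čech families with the same membership condition are equal. [folklore] -/
theorem cechFam_eq_cechFam {κ' : Type} [LinearOrder κ'] {P : X → Submodule A 𝕂} {Ω Ω' : Opens X}
    {W : κ → Opens X} {W' : κ' → Opens X} {t : Finset κ} {t' : Finset κ'}
    (h : ∀ x, (x ∈ Ω ∧ ∀ a ∈ t, x ∈ W a) ↔ (x ∈ Ω' ∧ ∀ a ∈ t', x ∈ W' a)) :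
    cechFam P Ω W t = cechFam P Ω' W' t' := by
  ext v
  rw [mem_cechFam, mem_cechFam]
  exact ⟨fun H x hx hx' => have h' := (h x).2 ⟨hx, hx'⟩; H x h'.1 h'.2,
    fun H x hx hx' => have h' := (h x).1 ⟨hx, hx'⟩; H x h'.1 h'.2⟩

/-- **The ordered Čech complex `Č•((Ω ∩ W_j)_{j ∈ S}, P)`** of the pointwise family `P` for the
members indexed by the finite set `S` inside `Ω`. [folklore] -/
abbrev cplx (P : X → Submodule A 𝕂) (Ω : Opens X) (W : κ → Opens X) (S : Finset κ) :
    CochainComplex (ModuleCat.{u} A) ℤ :=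
  complex (cechFam P Ω (fun j : ↥S => W ↑j)) (cechFam_mono P Ω _)

/-- The inclusion `J ⊆ T` as an order embedding of index types. [folklore] -/
def incl {J T : Finset κ} (hJT : J ⊆ T) : ↥J ↪o ↥T :=
  OrderEmbedding.ofMapLEIff (fun j => ⟨j.1, hJT j.2⟩) fun _ _ => Iff.rfl

/-- The value of `incl`. [folklore] -/
@[simp] theorem coe_incl {J T : Finset κ} (hJT : J ⊆ T) (j : ↥J) : ((incl hJT j : ↥T) : κ) = j := rfl

/-- The Čech families of `T` and of `J ⊆ T` agree on the simplices of `J`. [folklore] -/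
theorem cechFam_map_incl (P : X → Submodule A 𝕂) (Ω : Opens X) (W : κ → Opens X) {J T : Finset κ}
    (hJT : J ⊆ T) (t : Finset ↥J) :
    cechFam P Ω (fun j : ↥T => W ↑j) (t.map (incl hJT).toEmbedding) =
      cechFam P Ω (fun j : ↥J => W ↑j) t := by
  refine cechFam_eq_cechFam fun x => and_congr_right fun _ => ⟨fun h a ha => ?_, fun h b hb => ?_⟩
  · exact h (incl hJT a) (Finset.mem_map_of_mem _ ha)
  · obtain ⟨a, ha, rfl⟩ := Finset.mem_map.1 hb
    exact h a ha

/-- **The restriction `Č•((W_j)_{j ∈ T}) → Č•((W_j)_{j ∈ J})` to a sub-covering `J ⊆ T`.**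
[cite: GortzWedhorn2023, (21.16) (pp. 260–261)] -/
def restrictJ (P : X → Submodule A 𝕂) (Ω : Opens X) (W : κ → Opens X) {J T : Finset κ}
    (hJT : J ⊆ T) : cplx P Ω W T ⟶ cplx P Ω W J :=
  restrictMapLE (incl hJT) (fun t => (cechFam_map_incl P Ω W hJT t).le) _ _

/-! ### Deleting acyclic members -/

/-- **Restriction to a sub-covering by deleting acyclic members** (Görtz–Wedhorn II, Thm. 22.9 with
Cor. 21.82, for pointwise families). Let `J ⊆ T` be finite sets of indices, `J ≠ ∅`, with
`(W_j)_{j ∈ J}` covering `Ω`. If for every `v ∈ T ∖ J` and every `J ⊆ S ⊆ T ∖ {v}` the Čech complex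
of `P` on `Ω ∩ W_v` for the members `(W_j)_{j ∈ S}` is exact in all degrees `≥ 1`, then
`Č•((Ω ∩ W_j)_{j ∈ T}, P) → Č•((Ω ∩ W_j)_{j ∈ J}, P)` is a quasi-isomorphism. (The degree-`0` part
of the link condition of `OrderedCech.quasiIso_restrictMapLE_of_forall` — sections over `Ω ∩ W_v`
are those families of sections over the `Ω ∩ W_v ∩ W_j` which agree — is automatic for pointwise
families.) [cite: GortzWedhorn2023, Thm. 22.9 with Cor. 21.82 (pp. 266, 332)] -/
theorem quasiIso_restrictJ (P : X → Submodule A 𝕂) (Ω : Opens X) (W : κ → Opens X) {J T : Finset κ}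
    (hJT : J ⊆ T) (hJ : J.Nonempty) (hcov : ∀ x ∈ Ω, ∃ j ∈ J, x ∈ W j)
    (hlink : ∀ v ∈ T, v ∉ J → ∀ S : Finset κ, J ⊆ S → S ⊆ T → v ∉ S → ∀ n : ℤ, 1 ≤ n →
      (cplx P (Ω ⊓ W v) W S).ExactAt n) :
    QuasiIso (restrictJ P Ω W hJT) := by
  obtain ⟨j₀, hj₀⟩ := hJ
  haveI : Nonempty ↥J := ⟨⟨j₀, hj₀⟩⟩
  refine quasiIso_restrictMapLE_of_forall _ _ (incl hJT) (cechFam_map_incl P Ω W hJT) ?_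
  intro v hv S' hS' hvS'
  -- translate to finite sets of `κ`
  have hvJ : (v : κ) ∉ J := fun h => hv ⟨⟨v, h⟩, Subtype.ext rfl⟩
  set S : Finset κ := S'.map (Function.Embedding.subtype _) with hS_def
  have hmemS : ∀ i : κ, i ∈ S ↔ ∃ h : i ∈ T, (⟨i, h⟩ : ↥T) ∈ S' := fun i => by
    rw [hS_def, Finset.mem_map]
    constructor
    · rintro ⟨a, ha, rfl⟩
      exact ⟨a.2, ha⟩
    · rintro ⟨h, ha⟩
      exact ⟨⟨i, h⟩, ha, rfl⟩
  have hJS : J ⊆ S := fun j hj => (hmemS j).2 ⟨hJT hj, hS' ⟨⟨j, hj⟩, rfl⟩⟩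
  have hST : S ⊆ T := fun i hi => ((hmemS i).1 hi).1
  have hvS : (v : κ) ∉ S := fun h => by
    obtain ⟨h', hmem⟩ := (hmemS v).1 h
    exact hvS' hmem
  refine ⟨?_, fun n hn => ?_⟩
  · -- (H0): the sheaf axiom for pointwise families
    intro z hz
    rw [mem_cechFam]
    intro x hx hxv
    obtain ⟨j, hj, hxj⟩ := hcov x hx
    have hz' := (Submodule.mem_iInf _).1 hz ⟨⟨j, hJT hj⟩, hS' ⟨⟨j, hj⟩, rfl⟩⟩
    rw [mem_cechFam] at hz'
    refine hz' x hx fun a ha => ?_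
    rcases Finset.mem_insert.1 ha with rfl | ha
    · exact hxv _ (Finset.mem_singleton_self _)
    · rw [Finset.mem_singleton.1 ha]
      exact hxj
  · -- (H1): the link, reindexed along `↥S' ≅ ↥S`
    let θ : ↥S' ↪o ↥S :=
      OrderEmbedding.ofMapLEIff (fun a => ⟨(a.1 : κ), (hmemS _).2 ⟨a.1.2, a.2⟩⟩) fun _ _ => Iff.rfl
    have hθ : Function.Surjective θ := fun b => by
      obtain ⟨h, hb⟩ := (hmemS b.1).1 b.2
      exact ⟨⟨⟨b.1, h⟩, hb⟩, Subtype.ext rfl⟩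
    have heqθ : ∀ t : Finset ↥S',
        cechFam P (Ω ⊓ W v) (fun j : ↥S => W ↑j) (t.map θ.toEmbedding) =
          insFamily (OrderEmbedding.subtype (· ∈ S')) v (cechFam P Ω fun j : ↥T => W ↑j) t := by
      intro t
      rw [insFamily_apply]
      refine cechFam_eq_cechFam fun x => ?_
      simp only [Opens.mem_inf, Finset.forall_mem_insert, Finset.forall_mem_map]
      constructor
      · rintro ⟨⟨hxΩ, hxv⟩, h⟩
        exact ⟨hxΩ, hxv, fun a ha => h a ha⟩
      · rintro ⟨hxΩ, hxv, h⟩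
        exact ⟨⟨hxΩ, hxv⟩, fun a ha => h a ha⟩
    haveI := isIso_restrictMapLE θ (fun t => (heqθ t).le) (cechFam_mono P _ _)
      (insFamily_mono _ _ (cechFam_mono P Ω _)) hθ heqθ
    exact (hlink v v.2 hvJ S hJS hST hvS n hn).of_iso
      (asIso (restrictMapLE θ (fun t => (heqθ t).le) (cechFam_mono P _ _)
        (insFamily_mono _ _ (cechFam_mono P Ω _))))

/-- **Recursive form of the link condition.** Suppose the members `(W_j)_{j ∈ J}` cover `X` and `P`
is Čech-acyclic, for the sub-covering `J` alone, on every intersection `Ω₀ ∩ W_s`, `∅ ≠ s ⊆ T`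
disjoint from `J`. Then `P` is Čech-acyclic on `Ω₀ ∩ W_s` for every intermediate covering
`J ⊆ S ⊆ T` disjoint from `s` (induction on `#(S ∖ J)`, deleting the extra members by
`quasiIso_restrictJ`). [cite: GortzWedhorn2023, Thm. 22.9 with Cor. 21.82 (pp. 266, 332)] -/
theorem exactAt_cplx_of_base (P : X → Submodule A 𝕂) (Ω₀ : Opens X) (W : κ → Opens X)
    {J T : Finset κ} (hJT : J ⊆ T) (hJ : J.Nonempty) (hcov : ∀ x, ∃ j ∈ J, x ∈ W j)
    (hbase : ∀ s : Finset κ, s ⊆ T → s.Nonempty → Disjoint s J → ∀ n : ℤ, 1 ≤ n →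
      (cplx P (Ω₀ ⊓ s.inf W) W J).ExactAt n)
    (s S : Finset κ) (hsT : s ⊆ T) (hs : s.Nonempty) (hJS : J ⊆ S) (hST : S ⊆ T)
    (hsS : Disjoint s S) (n : ℤ) (hn : 1 ≤ n) : (cplx P (Ω₀ ⊓ s.inf W) W S).ExactAt n := by
  classical
  suffices key : ∀ (k : ℕ) (s S : Finset κ), s ⊆ T → s.Nonempty → J ⊆ S → S ⊆ T → Disjoint s S →
      (S \ J).card ≤ k → ∀ n : ℤ, 1 ≤ n → (cplx P (Ω₀ ⊓ s.inf W) W S).ExactAt n from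
    key _ s S hsT hs hJS hST hsS le_rfl n hn
  intro k
  induction k with
  | zero =>
    intro s S hsT hs hJS hST hsS hk n hn
    have hSJ : S = J := by
      refine Finset.Subset.antisymm (fun i hi => ?_) hJS
      by_contra h
      have : i ∈ S \ J := Finset.mem_sdiff.2 ⟨hi, h⟩
      rw [Nat.le_zero, Finset.card_eq_zero] at hk
      rw [hk] at this
      exact Finset.notMem_empty _ this
    subst hSJ
    exact hbase s hsT hs hsS n hn
  | succ k ih =>
    intro s S hsT hs hJS hST hsS hk n hn
    haveI := quasiIso_restrictJ P (Ω₀ ⊓ s.inf W) W hJS hJ (fun x _ => hcov x)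
      fun v hv hvJ S' hJS' hS'S hvS' m hm => by
        have e : Ω₀ ⊓ s.inf W ⊓ W v = Ω₀ ⊓ (insert v s).inf W := by
          rw [Finset.inf_insert, inf_assoc, inf_comm (s.inf W)]
        rw [e]
        refine ih (insert v s) S' (Finset.insert_subset (hST hv) hsT) (Finset.insert_nonempty _ _)
          hJS' (hS'S.trans hST) ?_ ?_ m hm
        · rw [Finset.disjoint_insert_left]
          exact ⟨hvS', Finset.disjoint_of_subset_right hS'S hsS⟩
        · have hsub : S' \ J ⊆ (S \ J).erase v := fun i hi => by
            rw [Finset.mem_erase, Finset.mem_sdiff]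
            rw [Finset.mem_sdiff] at hi
            exact ⟨fun h => hvS' (h ▸ hi.1), hS'S hi.1, hi.2⟩
          have hcard := Finset.card_le_card hsub
          rw [Finset.card_erase_of_mem (Finset.mem_sdiff.2 ⟨hv, hvJ⟩)] at hcard
          omega
    exact (exactAt_iff_of_quasiIsoAt (restrictJ P (Ω₀ ⊓ s.inf W) W hJS) n).2
      (hbase s hsT hs (Finset.disjoint_of_subset_right hJS hsS) n hn)

/-- **Restriction to a covering sub-family is a quasi-isomorphism as soon as `P` is Čech-acyclic,
for the sub-family, on the intersections of the deleted members** (`quasiIso_restrictJ` with its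
link condition in the recursive form `exactAt_cplx_of_base`). For a Chow cover `π : V' → V` and
`W = (π⁻¹U_a)_a ∪ (D₊(x_j) ∩ V')_j`, `J` = the second family, the hypothesis is Serre's vanishing
theorem on the `π⁻¹(U_s)`. [cite: GortzWedhorn2023, Thm. 22.9 (p. 332) and Lemma 23.19 (p. 425)] -/
theorem quasiIso_restrictJ_of_base (P : X → Submodule A 𝕂) (Ω₀ : Opens X) (W : κ → Opens X)
    {J T : Finset κ} (hJT : J ⊆ T) (hJ : J.Nonempty) (hcov : ∀ x, ∃ j ∈ J, x ∈ W j)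
    (hbase : ∀ s : Finset κ, s ⊆ T → s.Nonempty → Disjoint s J → ∀ n : ℤ, 1 ≤ n →
      (cplx P (Ω₀ ⊓ s.inf W) W J).ExactAt n) :
    QuasiIso (restrictJ P Ω₀ W hJT) :=
  quasiIso_restrictJ P Ω₀ W hJT hJ (fun x _ => hcov x) fun v hv hvJ S hJS hST hvS n hn => by
    have e : Ω₀ ⊓ W v = Ω₀ ⊓ ({v} : Finset κ).inf W := by rw [Finset.inf_singleton]
    rw [e]
    exact exactAt_cplx_of_base P Ω₀ W hJT hJ hcov hbase {v} S (Finset.singleton_subset_iff.2 hv)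
      (Finset.singleton_nonempty v) hJS hST (Finset.disjoint_singleton_left.2 hvS) n hn

end General

/-! ### Affine members -/

section Affine

variable {Y : Scheme.{u}} [IsIntegral Y] {A : Type u} [CommRing A] [Algebra A Y.functionField]
variable {κ : Type} [LinearOrder κ]

/-- **The Čech complex of a principal pointwise family on an affine open with affine intersections
is exact in all degrees `≠ 0`** (Görtz–Wedhorn II, Lemma 22.1 / Thm. 22.2, in the form
`AffineCech.exactAt_complex_of_affine` of `Motives/AffineCechAcyclic`): `Ω` affine and non-empty,
members `W_j ∋ ξ` (`j ∈ S`) covering `Ω` with all `Ω ∩ W_t` affine, and `P x = {z ; φ z ∈ 𝒪_{Y,x}}`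
on `Ω`. [cite: GortzWedhorn2023, Lemma 22.1 (p. 327) and Thm. 22.2 (p. 328)] -/
theorem exactAt_cplx_of_affine (P : Y → Submodule A Y.functionField) (Ω : Y.Opens)
    (hΩ : IsAffineOpen Ω) (W : κ → Y.Opens) (S : Finset κ) (hξΩ : genericPoint Y ∈ Ω)
    (hξW : ∀ j ∈ S, genericPoint Y ∈ W j) (hcov : ∀ x ∈ Ω, ∃ j ∈ S, x ∈ W j)
    (haff : ∀ t : Finset κ, t ⊆ S → IsAffineOpen (Ω ⊓ t.inf W)) (φ : Y.functionField)
    (hP : ∀ x ∈ Ω, ∀ z, z ∈ P x ↔ RatFn.IsRegularAt x (φ * z)) (n : ℤ) (hn : n ≠ 0) :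
    (cplx P Ω W S).ExactAt n := by
  refine AffineCech.exactAt_complex_of_affine Ω hΩ hξΩ (fun j : ↥S => W ↑j) (fun x hx => ?_)
    (fun t => Ω ⊓ t.inf fun j : ↥S => W ↑j) (fun t y => ?_) (fun t => ?_) (fun t => ?_) φ _
    (cechFam_mono P Ω _) (fun t z => ?_) n hn
  · obtain ⟨j, hj, hxj⟩ := hcov x hx
    exact Opens.mem_iSup.2 ⟨⟨j, hj⟩, hxj⟩
  · rw [Opens.mem_inf, mem_finset_inf]
  · exact ⟨hξΩ, mem_finset_inf.2 fun a _ => hξW a a.2⟩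
  · have e : (t.map (Function.Embedding.subtype (· ∈ S))).inf W = t.inf fun j : ↥S => W ↑j := by
      rw [Finset.inf_map]; rfl
    rw [← e]
    refine haff _ fun i hi => ?_
    obtain ⟨a, _, rfl⟩ := Finset.mem_map.1 hi
    exact a.2
  · rw [cechFam, mem_secs]
    exact ⟨fun h y hy => (hP y hy.1 z).1 (h y hy), fun h y hy => (hP y hy.1 z).2 (h y hy)⟩

/-- **Deleting affine members**: if the members `(W_i)_{i ∈ I}` cover `Y`, all members are non-empty,
and every other member `W_v`, `v ∈ T ∖ I`, is affine with all `W_v ∩ W_t` (`t ⊆ T`) affine and `P`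
principal on `W_v`, then `Č•((W_j)_{j ∈ T}, P) → Č•((W_i)_{i ∈ I}, P)` is a quasi-isomorphism
(Görtz–Wedhorn II, Thm. 22.9 for the pointwise family `P`; the links are exact by Lemma 22.1).
[cite: GortzWedhorn2023, Thm. 22.9 (p. 332) with Lemma 22.1 (p. 327)] -/
theorem quasiIso_restrictJ_of_affine (P : Y → Submodule A Y.functionField) (W : κ → Y.Opens)
    {I T : Finset κ} (hIT : I ⊆ T) (hI : I.Nonempty) (hcov : ∀ x, ∃ i ∈ I, x ∈ W i)
    (hξ : ∀ j ∈ T, genericPoint Y ∈ W j)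
    (haff : ∀ v ∈ T, v ∉ I → ∀ t : Finset κ, t ⊆ T → IsAffineOpen (W v ⊓ t.inf W))
    (hP : ∀ v ∈ T, v ∉ I → ∃ φ : Y.functionField, ∀ x ∈ W v, ∀ z,
      z ∈ P x ↔ RatFn.IsRegularAt x (φ * z)) :
    QuasiIso (restrictJ P ⊤ W hIT) := by
  refine quasiIso_restrictJ P ⊤ W hIT hI (fun x _ => hcov x) fun v hv hvI S hIS hST hvS n hn => ?_
  obtain ⟨φ, hφ⟩ := hP v hv hvI
  rw [top_inf_eq]
  have hΩ : IsAffineOpen (W v) := by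
    have := haff v hv hvI ∅ (Finset.empty_subset _)
    rwa [Finset.inf_empty, inf_top_eq] at this
  refine exactAt_cplx_of_affine P (W v) hΩ W S (hξ v hv) (fun j hj => hξ j (hST hj))
    (fun x _ => ?_) (fun t ht => haff v hv hvI t (ht.trans hST)) φ hφ n (by omega)
  obtain ⟨i, hi, hxi⟩ := hcov x
  exact ⟨i, hIS hi, hxi⟩

end Affine

end PtFamily

end Literature.AlgebraicGeometry.Motives

end
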